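import Literature.Analysis.SpecialFunctions.ZhouTripleEllipticIntegralWick
import HarnessLib

/-!
# Zhou 2013, Proposition 5.1 — reduction to Corollary 3.2 as printed

Sequel of `ZhouTripleEllipticIntegralWick.lean`. There, Prop. 5.1 (`Zhou2013_prop_5_1`:
`∫₀¹K(√(1−k²))³dk = Γ(¼)⁸/(128π²)`) is reduced to the value recalled at the end of its printed proof,
`6∫₀¹[K(k)]²K(√(1−k²))k dk = [Γ(¼)]⁸/(128π²)` (`Zhou2013_prop_5_1_of_T_half_half`). That value is
Zhou's eq. (T_half_half), PRINTED as the third line of Corollary 3.2 (arXiv:1301.1735, p. 15):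

  `(π³/8)T_{−1/2,−1/2} = 2∫₀¹[K(√(1−t))]²K(√t)dt = [Γ(¼)]⁸/(192π²)`.

Here the two forms are identified by the substitution `t = k²`
(`∫₀¹[K(√(1−t))]²K(√t)dt = 2∫₀¹K(√(1−k²))²K(k)k dk`) and the symmetry `∫₀¹KK′²k = ∫₀¹K²K′k`
(`integral_K_mul_compl_sq_mul_id`), so that the one missing input of Prop. 5.1 is exactly the printed
Cor. 3.2 statement: `Zhou2013_prop_5_1_of_cor_3_2`. Everything is proved; no definition, no named fact.

## References

* [Zhou2013] Y. Zhou, Ramanujan J. 34 (2014) 373–428: Prop. 5.1 (arXiv p. 23), Cor. 3.2 eq.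
  (T_half_half) (arXiv p. 15).
-/

noncomputable section

open Real _root_.MeasureTheory _root_.Set

namespace Literature.Analysis.SpecialFunctions

/-- Change of variables `t = k²` (an increasing diffeomorphism of `(0,1)`; `dt/dk = 2k`):
`∫_{(0,1)} g(t) dt = ∫_{(0,1)} 2k·g(k²) dk`, for every `g`. [folklore] -/
theorem integral_Ioo_comp_sq (g : ℝ → ℝ) :
    ∫ t in Ioo (0 : ℝ) 1, g t = ∫ k in Ioo (0 : ℝ) 1, 2 * k * g (k ^ 2) := by
  set φ : ℝ → ℝ := fun k => k ^ 2 with hφ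
  have himage : φ '' Ioo (0 : ℝ) 1 = Ioo 0 1 := by
    ext t
    constructor
    · rintro ⟨k, hk, rfl⟩
      exact ⟨by simp only [hφ]; nlinarith [hk.1, hk.2], by simp only [hφ]; nlinarith [hk.1, hk.2]⟩
    · intro ht
      refine ⟨Real.sqrt t, ⟨Real.sqrt_pos.mpr ht.1, (Real.sqrt_lt' one_pos).mpr (by linarith [ht.2])⟩, ?_⟩
      simp only [hφ]
      exact Real.sq_sqrt ht.1.le
  have hderiv : ∀ k ∈ Ioo (0 : ℝ) 1, HasDerivWithinAt φ (2 * k) (Ioo 0 1) k := fun k _ =>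
    ((hasDerivAt_pow 2 k).congr_deriv (by norm_num)).hasDerivWithinAt
  have hinj : InjOn φ (Ioo 0 1) := fun a ha b hb hab =>
    (pow_left_inj₀ ha.1.le hb.1.le two_ne_zero).mp hab
  have key := integral_image_eq_integral_abs_deriv_smul measurableSet_Ioo hderiv hinj g
  rw [himage] at key
  rw [key]
  refine setIntegral_congr_fun measurableSet_Ioo (fun k hk => ?_)
  rw [smul_eq_mul, abs_of_pos (by linarith [hk.1])]

/-- **Cor. 3.2 form ↔ Prop. 5.1 form of the value**: `∫₀¹[K(√(1−t))]²K(√t)dt = 2∫₀¹K(k)²K(√(1−k²))k dk`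
(substitution `t = k²`, then `∫₀¹KK′²k = ∫₀¹K²K′k`). [cite: Zhou2013, Cor. 3.2 eq. (T_half_half) and Prop. 5.1] -/
theorem integral_Kcompl_sq_mul_K_sqrt_eq :
    ∫ t in Ioo (0 : ℝ) 1, completeEllipticK (Real.sqrt (1 - t)) ^ 2 * completeEllipticK (Real.sqrt t) =
      2 * ∫ k in Ioo (0 : ℝ) 1, completeEllipticK k ^ 2 * completeEllipticK (Real.sqrt (1 - k ^ 2)) * k := by
  rw [integral_Ioo_comp_sq, ← integral_K_mul_compl_sq_mul_id, ← integral_const_mul]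
  refine setIntegral_congr_fun measurableSet_Ioo (fun k hk => ?_)
  rw [Real.sqrt_sq hk.1.le]
  ring

/-- **Reduction of Prop. 5.1 to Corollary 3.2 as printed** ("`2∫₀¹[K(√(1−t))]²K(√t)dt = [Γ(¼)]⁸/(192π²)`",
the third line of Cor. 3.2, eq. (T_half_half)): given that printed value, `Zhou2013_prop_5_1` follows
from the five chain equalities of Prop. 5.1 proved in the tree (layers (a)+(b)). The Cor. 3.2 value
itself (Prop. 3.1 at `ν = −1/2`) is NOT proved in the tree. [cite: Zhou2013, Cor. 3.2 eq. (T_half_half) (arXiv p. 15) and Prop. 5.1 (last step of its proof, p. 23)] -/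
theorem Zhou2013_prop_5_1_of_cor_3_2
    (h : 2 * ∫ t in Ioo (0 : ℝ) 1, completeEllipticK (Real.sqrt (1 - t)) ^ 2 * completeEllipticK (Real.sqrt t) =
      Real.Gamma (1 / 4) ^ 8 / (192 * Real.pi ^ 2)) :
    Zhou2013_prop_5_1 := by
  apply Zhou2013_prop_5_1_of_T_half_half
  rw [integral_Kcompl_sq_mul_K_sqrt_eq] at h
  have hpi : Real.pi ≠ 0 := Real.pi_pos.ne'
  field_simp
  field_simp at h
  linarith

end Literature.Analysis.SpecialFunctions

end
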